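import Mathlib.RingTheory.RegularLocalRing.Defs
import Mathlib.RingTheory.DiscreteValuationRing.TFAE
import Mathlib.RingTheory.Ideal.Height
import Mathlib.RingTheory.Valuation.ValuationRing
import Mathlib.RingTheory.Localization.AtPrime.Basic
import Literature.AlgebraicGeometry.Resolution.RegularLocalRingsNormal
import HarnessLib

/-!
# A regular local ring of dimension one is a valuation ring (crux `WildPurity.PurityTransfer`, line `birth`)

Stub `stub_heightOneValuationRing` of the lead's skeleton for crux
stmt-ResolutionOfSingularities-17142 (route `ResolutionOfSingularities/WildPurity`, Kato valuative
purity above a resolvable affine model). The composition `PurityTransfer_of` feeds the crux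
hypothesis with the divisorial places `placeOfPrime A' P _` at the height-one primes `P` of a
finitely generated chart `A' ⊆ K` all of whose local rings are regular, and `placeOfPrime` wants
`ValuationRing (Localization.AtPrime P)`. This file supplies exactly that.

Proof (Matsumura, *Commutative Ring Theory*, Thm. 11.2 with Thm. 19.4): `L := A_P` is a domain
(`A ⊆ K` is a subring of a field), Noetherian and local (fields of `IsRegularLocalRing`), integrally
closed (`isIntegrallyClosed_of_isRegularLocalRing`, Matsumura 19.4, proved in the tree), and of Krull
dimension `ht P = 1` (`IsLocalization.AtPrime.ringKrullDim_eq_height`), so its non-zero primes are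
maximal; by `tfae_of_isNoetherianRing_of_isLocalRing_of_isDomain` (integrally closed with every
non-zero prime maximal `→` valuation ring) it is a valuation ring. Adapted from the tree's
`isDiscreteValuationRing_localization_of_height_eq_one` (`DivisorialPlace.lean`), where Noetherianity
and normality of the localisation come from global hypotheses on `A`; here they come from regularity.
-/

-- single-problem summit: the doubled namespace component `ResolutionOfSingularities` is forced
set_option linter.dupNamespace false

open IsLocalRing Literature.AlgebraicGeometry.Resolution

namespace Summit.ResolutionOfSingularities.ResolutionOfSingularities.Theorems.WildPurityPurityTransfer

/-- **A regular local domain of dimension at most one is a valuation ring** (Matsumura, Thm. 11.2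
with Thm. 19.4): a regular local ring is an integrally closed Noetherian local ring; if it is moreover
a domain of Krull dimension `≤ 1`, every non-zero prime is maximal, so it is a valuation ring by
`tfae_of_isNoetherianRing_of_isLocalRing_of_isDomain`. [cite: Matsumura1987, Thm. 11.2 and Thm. 19.4] -/
theorem valuationRing_of_isRegularLocalRing_of_krullDimLE_one (L : Type*) [CommRing L] [IsDomain L]
    [IsRegularLocalRing L] [Ring.KrullDimLE 1 L] : ValuationRing L :=
  have h : IsIntegrallyClosed L ∧ ∀ Q : Ideal L, Q ≠ ⊥ → Q.IsPrime → Q = maximalIdeal L :=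
    ⟨isIntegrallyClosed_of_isRegularLocalRing L, fun Q hQ0 hQp =>
      IsLocalRing.eq_maximalIdeal (Ring.krullDimLE_one_iff_of_noZeroDivisors.mp ‹_› Q hQ0 hQp)⟩
  ((tfae_of_isNoetherianRing_of_isLocalRing_of_isDomain L).out 3 1).mp h

/-- **STUB `stub_heightOneValuationRing` (crux `PurityTransfer`, line `birth`).** For a subalgebra
`A` of a field `K` and a prime `P` of `A` of height one with `A_P` regular, `A_P` is a valuation
ring: `A_P` is a domain, regular local (hence integrally closed Noetherian local), of Krull dimension
`ht P = 1` (`IsLocalization.AtPrime.ringKrullDim_eq_height`), so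
`valuationRing_of_isRegularLocalRing_of_krullDimLE_one` applies.
[cite: Matsumura1987, Thm. 11.2 and Thm. 19.4] -/
theorem stub_heightOneValuationRing (k K : Type) [Field k] [Field K] [Algebra k K]
    (A : Subalgebra k K) (P : Ideal A) [P.IsPrime]
    (hreg : IsRegularLocalRing (Localization.AtPrime P)) (hP : P.height = 1) :
    ValuationRing (Localization.AtPrime P) := by
  have hdim : ringKrullDim (Localization.AtPrime P) = 1 := by
    rw [IsLocalization.AtPrime.ringKrullDim_eq_height P (Localization.AtPrime P), hP,
      WithBot.coe_one]
  haveI : Ring.KrullDimLE 1 (Localization.AtPrime P) :=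
    Ring.krullDimLE_iff.mpr (by rw [Nat.cast_one]; exact hdim.le)
  exact valuationRing_of_isRegularLocalRing_of_krullDimLE_one (Localization.AtPrime P)

end Summit.ResolutionOfSingularities.ResolutionOfSingularities.Theorems.WildPurityPurityTransfer
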